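import Summits.QuantumFields.QCD.Theses.SpectralDefectExtinction
import Summits.QuantumFields.QCD.Theorems.SpectralDefectExtinctionWindowExtinctionChessboardDefs
import Summits.QuantumFields.QCD.Theorems.SpectralDefectExtinctionTipPricingIntensiveTightOfMoments
import Summits.QuantumFields.QCD.Theorems.SpectralDefectExtinctionTipPricingTightOfIndexMoments
import HarnessLib.Audit

/-!
# Birth skeleton (BC3) for the RESTATED crux `WindowExtinction` = SD⁺ (item stmt-QuantumFields-18063)

Route `SpectralDefectExtinction` (sub-problem QCD), crux decl
`Summit.QuantumFields.QCD.Theses.SpectralDefectExtinction.WindowExtinction` as restated 2026-08-17 (rev ≥ 9: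
SD + polynomial volume cap R1 + branch clause + extensive pin TIGHT⁺ R2).  Registered by the skeleton-registrar seat
`planner-skel-stmt-QuantumFields-18063-0` (route re-audit bin REPAIRABLE, 2026-08-17) as `Cruxes/WindowExtinction/Lines/birth.lean`.
It is the route-level BIRTH CERTIFICATE of the restated crux (≥ 2 named stubs, kernel-checked composition concluding the
crux BY NAME, sorries only inside `stub_*`), deliberately LINE-NEUTRAL: it cuts SD⁺ along the route's own two-layer plan
(`WindowExtinction ⇐ DeepExtinction → DressConcentration → TightPlus`, route header TWO-LAYER PLAN) into the two pieces
that are UNIVERSAL laws over the admissible capped class and the one piece that must exhibit the witness line: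

* `stub_deepExtinction : DeepExtinctionStmt` (∀-law, size L, open) — for EVERY mass-scaling, asymptotically scaling
  regularisation with polynomial volume cap whose line tends to `0` (`N_f ≤ 16`), the DEEP real modes of the massless
  `r = 1` Wilson–Dirac operator (below `deepConst/β_k`, `deepConst = 1/1600`) are EXTINCT in the crux's phase-quenched
  normalisation for every positive mass tuple (`ChessboardColdCells.DeepExtinctAt`, landed vocabulary p98783).  Along the
  chessboard line this is a THEOREM modulo its two open inputs (`stub_deep` p111185 + `stub_kyFan` p106245 + `stub_geometry`
  p104629 + odd-torus chessboard p111545, given `ColumnPatternCost` and `TransferStmt`; the polynomial cap implies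
  `SubGaussianVolume` under asymptotic scaling by `AFBookkeeping`); any other pricing of deep defects proves it too.
* `stub_edgeWitness : EdgeWitnessStmt` (the ∃-piece, open-problem; the residual physical content) — for `N_f ∈ {2,3}` an
  admissible capped line `m_crit(k) → 0` with threshold `M₀` and window constant `c` such that for every tuple `m > M₀`:
  the BAND half of EXTINCT (clause (a) above the deep threshold, clause (b)) GIVEN deep extinction, and the intensive
  SUSCEPTIBILITY FLOOR of the index just past the line, `E₊[Q_k(M)²] ≥ χ₀ (a_k(2L_k+1))⁴ = χ₀ V_phys` with `Z_k > 0`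
  (`χ_t > 0` under the `|det|` weights: Leutwyler–Smilga / Smilga 2001 (16.9)).  This is where the line is PINNED: EXTINCT
  forbids placing `m_crit(k)` below the physical real-mode accumulation edge by `≫ a_k m_f/Z_k`, the floor forbids placing
  it above by `≫ a_k M₀/Z_k`.
* `stub_kurtosisCap : KurtosisStmt` (∀-law, size M/L, open) — for EVERY admissible capped line and tuple: the
  susceptibility floor implies a fourth-moment CAP `E₊[Q⁴] ≤ K₄ (E₊[Q²])²` uniformly in the probe `M > M₀` (extensive
  cumulants / CLT for the quasi-local index cocycle under the phase-quenched measure — the route's Move 1: cocycle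
  locality on window-clean pairs p104175 and Aizenman–Graf screening in mean p108317–p111342 are the landed tools).

`WindowExtinction_of : DeepExtinctionStmt → EdgeWitnessStmt → KurtosisStmt → WindowExtinction` is kernel-checked: the
branch clause is DERIVED from `m_crit(k) → 0`; EXTINCT is the band implication fed with deep extinction for the witness;
TIGHT⁺ (with its `max 1`) follows from FLOOR + CAP by the LANDED intensive Hölder `(3/2,3)` step
`TightFromTwoMoments.intensiveTight_of_indexMoments` (p-landed, Theorems/…TipPricingIntensiveTightOfMoments.lean) and
`physVolume_eventually_ge` (`a_k L_k → ∞` absorbs the floor `1`) — the argument of the landed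
`TightFromTwoMoments.tightPlus_of_indexMoments` (Theorems/…TipPricingTightPlusOfMoments.lean, 2026-08-17), re-derived here in
twelve lines because that module is not yet in the farm snapshot; `windowExtinction_of_stubs : WindowExtinction` instantiates it.

## Negative knowledge honoured (read 2026-08-17: `Cruxes/WindowExtinction/Disproof.lean`; `Theorems/WindowExtinction/Negative/*`;
## `Theorems/ExtinctionBuildsQCD/Negative/{WithoutTightPlusCollapse, NearTipBand→WindowExtinction/Negative, VolumeLever(Box), TightPinsLine, UniformTight}`)
* LOAD-BEARING = TIGHT⁺ (`NearTipBand.sdPlus_without_tightPlus_inhabited`, `WithoutTightPlusCollapse` §2⁺, Disproof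
  `extinctOnly_holds`): SD⁺ minus TIGHT⁺ is inhabited by `canonicalAF` / near-tip lines.  Here the index content is carried by
  the FLOOR (inside `stub_edgeWitness`, for the SAME `reg` that carries EXTINCT) and the CAP (`stub_kurtosisCap`); FLOOR + CAP ⇒
  TIGHT⁺ ⇒ FLOOR (Cauchy–Schwarz), so no stub weakens the pin, and the junk families fail FLOOR exactly as they fail TIGHT⁺
  under the cap (`WithoutTightPlusCollapse`, "why TIGHT⁺ resists a junk witness").  `stub_deepExtinction` and
  `stub_kurtosisCap` are ∀-laws: no witness, nothing to inhabit hollowly.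
* QUANTIFIER ORDER (`Negative/UniformTight`, Disproof §7 `not_windowExtinctionUniformM`): FLOOR and CAP keep `∀ M > M₀, ∀ᶠ k`.
* WINDOW CONSTANT `c ≤ 1` (Disproof §10 `windowConstant_le_one`, `CoercivityCeiling`): `c` stays existential; no `c > 1` asserted.
* THE PIN (`TightPinsLine`, Disproof §4 `tight_pins_mcrit`): TIGHT forces `m_crit(k) ∈ [−8 + a_kM/Z_k, a_kM/Z_k]`; the witness
  class carries `m_crit(k) → 0` (physical edge `≈ −0.87/β_k`), from which the BRANCH clause is derived, not assumed.
* VOLUME LEVER (`VolumeLever`, `VolumeLeverBox`, `ThresholdCollapse`): the free-volume tip witnesses violate the polynomial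
  cap, which the witness class carries verbatim (R1).
* No stub is an instance of a landed Negative lemma; `ledger negatives --problem QuantumFields` (read 2026-08-17: 5 entries —
  RobustYangMillsRG stmt-14958, MirrorModularBoosts stmt-9665, AdaptiveCoarseSystem stmt-9494, MultibosonLatticeGap stmt-9599,
  AdmissibleRootsExist stmt-9603) — none concerns Wilson spectral-defect counts or index moments.

## BC3 probes (planner folder `bc/`): for each stub `S`, `S → WindowExtinction` and `S → QCD` by
`first | exact? | simpa | aesop` FAIL (files `bc/birth_probe_<stub>.lean`, outputs in NOTES.md).
-/

noncomputable section

namespace Summit.QuantumFields.QCD.Cruxes.WindowExtinction.Birth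

open scoped BigOperators Topology Classical
open MeasureTheory Filter
open Literature.MathematicalPhysics.QuantumLattice Literature.MathematicalPhysics.QuantumFieldTheory
  Literature.Probability.LatticeModels
open Summit.QuantumFields.QCD.Theses.SpectralDefectExtinction
open Summit.QuantumFields.QCD.Cruxes.WindowExtinction.ChessboardColdCells (deepConst DeepExtinctAt)
open Summit.QuantumFields.QCD.Cruxes.TipPricing.TightFromTwoMoments
  (intensiveTight_of_indexMoments physVolume_eventually_ge)

/-! ## §0 Currency: the clauses of the restated crux, verbatim -/

/-- **(R1) Polynomial volume cap** of a regularisation: `L_k ≤ a_k^{-p}` eventually, for some `p` (verbatim clause of SD⁺). -/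
def PolyCap {Nf : ℕ} (reg : QCDRegularisation Nf) : Prop :=
  ∃ p : ℕ, ∀ᶠ k : ℕ in Filter.atTop, (reg.L k : ℝ) ≤ (reg.a k)⁻¹ ^ p

/-- **EXTINCT** clause of SD⁺ for witness data `(reg, c)` at the mass tuple `m` (verbatim from the route file; identical
to `ExtinctionBuildsQCD.Negative.Extinct`, which is not imported here because its module's §0 no longer elaborates from
source against the restated route file). -/
def Extinct (Nf : ℕ) (reg : QCDRegularisation Nf) (c : ℝ) (m : Fin Nf → ℝ) : Prop :=
  ∀ ε : ℝ, 0 < ε → ∀ᶠ k : ℕ in Filter.atTop, ∀ S : ℕ, reg.L k ≤ S → (∫ U, ((∑ f : Fin Nf, ((Multiset.countP (fun z : ℂ => z.im = 0 ∧ z.re < -(reg.mcrit k + reg.a k * m f / reg.Zm k)) (wilsonDirac (fundamentalRep (Fin 3)) U 0 1).charpoly.roots : ℝ) + (Multiset.countP (fun z : ℂ => |z.re| < c * (reg.a k * m f / reg.Zm k)) (spinorLift gammaFive * wilsonDirac (fundamentalRep (Fin 3)) U (reg.mcrit k + reg.a k * m f / reg.Zm k) 1).charpoly.roots : ℝ))))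 * ∏ f : Fin Nf, ‖fermionDet (wilsonDirac (fundamentalRep (Fin 3)) U (reg.mcrit k + reg.a k * m f / reg.Zm k) 1)‖ ∂(wilsonMeasure (d := 4) (L := 2 * S + 1) (fundamentalRep (Fin 3)) (reg.β k))) / (∫ U, ∏ f : Fin Nf, ‖fermionDet (wilsonDirac (fundamentalRep (Fin 3)) U (reg.mcrit k + reg.a k * m f / reg.Zm k) 1)‖ ∂(wilsonMeasure (d := 4) (L := 2 * S + 1) (fundamentalRep (Fin 3)) (reg.β k))) ≤ ε * ((2 * S + 1 : ℝ) / (2 * reg.L k + 1)) ^ 4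

/-- **TIGHT⁺** clause of SD⁺ for witness data `(reg, M₀)` at the mass tuple `m` (verbatim from the route file; the
extensive pin `max 1 (η (a_k(2L_k+1))²) ≤ E₊|Q_k(M)|`, `Q_k(M) = n₋(Γ₅D_W(U, m_crit(k) − a_kM/Z_k, 1)) − 6(2L_k+1)⁴`). -/
def TightPlus (Nf : ℕ) (reg : QCDRegularisation Nf) (M₀ : ℝ) (m : Fin Nf → ℝ) : Prop :=
  ∃ η : ℝ, 0 < η ∧ ∀ M : ℝ, M₀ < M → ∀ᶠ k : ℕ in Filter.atTop, max 1 (η * (reg.a k * (2 * reg.L k + 1 : ℝ)) ^ 2) ≤ (∫ U, (|(Multiset.countP (fun z : ℂ => z.re < 0) (spinorLift gammaFive * wilsonDirac (fundamentalRep (Fin 3)) U (reg.mcrit k - reg.a k * M / reg.Zm k) 1).charpoly.roots : ℝ) - 6 * (2 * reg.L k + 1 : ℝ) ^ 4|) * ∏ f : Fin Nf, ‖fermionDet (wilsonDirac (fundamentalRep (Fin 3)) U (reg.mcrit k + reg.a k * m f / reg.Zm k) 1)‖ ∂(wilsonMeasure (d := 4) (L := 2 * reg.L k + 1) (fundamentalRep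 (Fin 3)) (reg.β k))) / (∫ U, ∏ f : Fin Nf, ‖fermionDet (wilsonDirac (fundamentalRep (Fin 3)) U (reg.mcrit k + reg.a k * m f / reg.Zm k) 1)‖ ∂(wilsonMeasure (d := 4) (L := 2 * reg.L k + 1) (fundamentalRep (Fin 3)) (reg.β k)))

/-- **Susceptibility FLOOR** of the index just past the line (intensive second moment, with a live partition
function): `∃ χ₀ > 0, ∀ M > M₀, ∀ᶠ k, 0 < Z_k ∧ χ₀ (a_k(2L_k+1))⁴ Z_k ≤ S₂(k, M)` where `Z_k = ∫ w_k`,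
`S_j(k,M) = ∫ Q_k(M)^j w_k`, `w_k = ∏_f |det D_W(U, m_f(k), 1)|` on the scheme torus — literally the floor hypothesis of
the landed `TightFromTwoMoments.tightPlus_of_indexMoments`.  Physics: `E₊[Q²] = χ_t V_phys (1 + o(1))` with `χ_t > 0`
(Leutwyler–Smilga; Smilga 2001 (16.9): `χ_t = Σ (Σ_f m_f⁻¹)⁻¹` for light flavours, quenched-like for heavy ones). -/
def SusceptibilityFloor (Nf : ℕ) (reg : QCDRegularisation Nf) (M₀ : ℝ) (m : Fin Nf → ℝ) : Prop :=
  ∃ χ₀ : ℝ, 0 < χ₀ ∧ ∀ M : ℝ, M₀ < M → ∀ᶠ k : ℕ in Filter.atTop,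
      0 < (∫ U, ∏ f : Fin Nf, ‖fermionDet (wilsonDirac (fundamentalRep (Fin 3)) U (reg.mcrit k + reg.a k * m f / reg.Zm k) 1)‖ ∂(wilsonMeasure (d := 4) (L := 2 * reg.L k + 1) (fundamentalRep (Fin 3)) (reg.β k))) ∧
        χ₀ * (reg.a k * (2 * reg.L k + 1 : ℝ)) ^ 4 * (∫ U, ∏ f : Fin Nf, ‖fermionDet (wilsonDirac (fundamentalRep (Fin 3)) U (reg.mcrit k + reg.a k * m f / reg.Zm k) 1)‖ ∂(wilsonMeasure (d := 4) (L := 2 * reg.L k + 1) (fundamentalRep (Fin 3)) (reg.β k)))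
          ≤ (∫ U, ((Multiset.countP (fun z : ℂ => z.re < 0) (spinorLift gammaFive * wilsonDirac (fundamentalRep (Fin 3)) U (reg.mcrit k - reg.a k * M / reg.Zm k) 1).charpoly.roots : ℝ) - 6 * (2 * reg.L k + 1 : ℝ) ^ 4) ^ 2 * ∏ f : Fin Nf, ‖fermionDet (wilsonDirac (fundamentalRep (Fin 3)) U (reg.mcrit k + reg.a k * m f / reg.Zm k) 1)‖ ∂(wilsonMeasure (d := 4) (L := 2 * reg.L k + 1) (fundamentalRep (Fin 3)) (reg.β k)))

/-- **Kurtosis CAP** of the index just past the line: `∃ K₄ > 0, ∀ M > M₀, ∀ᶠ k, S₄(k,M) Z_k ≤ K₄ S₂(k,M)²`, i.e.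
`E₊[Q⁴] ≤ K₄ (E₊[Q²])²` — literally the cap hypothesis of the landed `tightPlus_of_indexMoments`. -/
def KurtosisCap (Nf : ℕ) (reg : QCDRegularisation Nf) (M₀ : ℝ) (m : Fin Nf → ℝ) : Prop :=
  ∃ K₄ : ℝ, 0 < K₄ ∧ ∀ M : ℝ, M₀ < M → ∀ᶠ k : ℕ in Filter.atTop,
      (∫ U, ((Multiset.countP (fun z : ℂ => z.re < 0) (spinorLift gammaFive * wilsonDirac (fundamentalRep (Fin 3)) U (reg.mcrit k - reg.a k * M / reg.Zm k) 1).charpoly.roots : ℝ) - 6 * (2 * reg.L k + 1 : ℝ) ^ 4) ^ 4 * ∏ f : Fin Nf, ‖fermionDet (wilsonDirac (fundamentalRep (Fin 3)) U (reg.mcrit k + reg.a k * m f / reg.Zm k) 1)‖ ∂(wilsonMeasure (d := 4) (L := 2 * reg.L k + 1) (fundamentalRep (Fin 3)) (reg.β k))) * (∫ U, ∏ f : Fin Nf, ‖fermionDet (wilsonDirac (fundamentalRep (Fin 3)) U (reg.mcrit k + reg.a k * m f / reg.Zm k) 1)‖ ∂(wilsonMeasure (d := 4) (L := 2 * reg.L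 k + 1) (fundamentalRep (Fin 3)) (reg.β k)))
          ≤ K₄ * (∫ U, ((Multiset.countP (fun z : ℂ => z.re < 0) (spinorLift gammaFive * wilsonDirac (fundamentalRep (Fin 3)) U (reg.mcrit k - reg.a k * M / reg.Zm k) 1).charpoly.roots : ℝ) - 6 * (2 * reg.L k + 1 : ℝ) ^ 4) ^ 2 * ∏ f : Fin Nf, ‖fermionDet (wilsonDirac (fundamentalRep (Fin 3)) U (reg.mcrit k + reg.a k * m f / reg.Zm k) 1)‖ ∂(wilsonMeasure (d := 4) (L := 2 * reg.L k + 1) (fundamentalRep (Fin 3)) (reg.β k))) ^ 2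

/-! ## §1 The three stub statements -/

/-- **(S1) Deep extinction over the admissible capped class** (∀-law).  For every `N_f ≤ 16` and every mass-scaling,
asymptotically scaling regularisation with polynomial volume cap whose line tends to `0`, and every positive mass tuple,
the phase-quenched expected number of real eigenvalues of `D_W(U,0,1)` below `deepConst/β_k` is `≤ ε((2S+1)/(2L_k+1))⁴`
on every torus `2S+1 ≥ 2L_k+1`, eventually in `k`, for every `ε > 0` (`DeepExtinctAt N_f reg deepConst m`).
Why plausibly true: a deep real mode forces a block with `≥ n_k⁴/128 ≈ 0.54 β_k²` `(flatLevel/β_k)`-flat spatial unit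
cubes (Kato lever p114069 + flat-cube dichotomy p104629 + Ky Fan counting p106245, all landed), which the odd-torus
reflection-positivity chessboard (p111545) prices at `≥ 7` nats per cube against `≤ 5.9 + o(1)` nats of placement entropy
(landed composition `stub_deep`, p111185), linearly in the torus volume; open inputs: the weak-coupling small-ball law
`ColumnPatternCost` and the one-nat `|det|` tilt `TransferStmt` of line `chessboard-cold-cells`.  Size: L. -/
def DeepExtinctionStmt : Prop :=
  ∀ (Nf : ℕ) (reg : QCDRegularisation Nf), Nf ≤ 16 → reg.HasMassScaling →
    (reg.scheme 0 0 0).HasAsymptoticScaling → PolyCap reg → Filter.Tendsto reg.mcrit Filter.atTop (nhds 0) →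
      ∀ m : Fin Nf → ℝ, (∀ f, 0 < m f) → DeepExtinctAt Nf reg deepConst m

/-- **(S2) The edge witness with its susceptibility floor** (∃-piece; open-problem).  For `N_f ∈ {2,3}` there is a
mass-scaling, asymptotically scaling regularisation with polynomial volume cap and `m_crit(k) → 0` (the phase-quenched real-mode
accumulation edge, `≈ −0.87/β_k`), a threshold `M₀ ≥ 0` and a window constant `c > 0` such that for every tuple `m > M₀`:
(i) BAND: if the deep real modes are extinct (S1, delivered for this very `reg`), the full EXTINCT clause holds — i.e. the real
modes in the band `[deepConst/β_k, −m_f(k))` (dressing concentration of smooth Krein-definite carriers, crux idea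
`krein-definite-dressing`) and the coercivity defects of clause (b) are extinct; (ii) FLOOR: the index just past the line has an
extensive second moment, `E₊[Q_k(M)²] ≥ χ₀ (a_k(2L_k+1))⁴`, `Z_k > 0`, for all probes `M > M₀`, eventually in `k`.
Why it might fail: the `N_f = 2` band defects must out-cost the entropy `1/b₀` although flatness is not rare at `t ≍ 0.87/β`;
sub-line real modes may be Krein-indefinite pairs; `χ_t > 0` under `|det|` weights on the capped torus is a continuum-grade
input.  Not junk-inhabited (heuristically, same mechanism as TIGHT⁺): `canonicalAF` / near-tip lines fail FLOOR under the cap,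
lines below the edge fail BAND.  Size: open-problem. -/
def EdgeWitnessStmt : Prop :=
  ∀ Nf : ℕ, (Nf = 2 ∨ Nf = 3) → ∃ reg : QCDRegularisation Nf,
    reg.HasMassScaling ∧ (reg.scheme 0 0 0).HasAsymptoticScaling ∧ PolyCap reg ∧
    Filter.Tendsto reg.mcrit Filter.atTop (nhds 0) ∧
    ∃ M₀ : ℝ, 0 ≤ M₀ ∧ ∃ c : ℝ, 0 < c ∧ ∀ m : Fin Nf → ℝ, (∀ f, M₀ < m f) →
      (DeepExtinctAt Nf reg deepConst m → Extinct Nf reg c m) ∧ SusceptibilityFloor Nf reg M₀ m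

/-- **(S3) Kurtosis cap from the floor over the admissible capped class** (∀-law).  For every `N_f ≤ 16`, every
mass-scaling, asymptotically scaling regularisation with polynomial volume cap and `m_crit(k) → 0`, every threshold
`M₀ ≥ 0` and tuple `m > M₀`: if the index just past the line has an extensive second moment (FLOOR) then its fourth moment
is capped, `E₊[Q_k(M)⁴] ≤ K₄ (E₊[Q_k(M)²])²` with ONE `K₄` for all probes `M > M₀`, eventually in `k`.  Why plausibly true:
the index is a quasi-local ℤ-cocycle of the links on window-clean configurations (landed p104175) screened in phase-quenched
mean (landed p108317–p111342), so its cumulants are extensive: `⟨Q⁴⟩_c = O(⟨Q²⟩)` once `⟨Q²⟩ → ∞`, whence kurtosis `→ 3`;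
rare-but-large index bursts would need coherent charge `N₀` at action cost `≳ N₀ β`.  Why it might fail: probes inside a
near-critical (Aoki-like) smear with long-range index correlations; joint rarity of clean windows.  Size: M/L. -/
def KurtosisStmt : Prop :=
  ∀ (Nf : ℕ) (reg : QCDRegularisation Nf), Nf ≤ 16 → reg.HasMassScaling →
    (reg.scheme 0 0 0).HasAsymptoticScaling → PolyCap reg → Filter.Tendsto reg.mcrit Filter.atTop (nhds 0) →
      ∀ M₀ : ℝ, 0 ≤ M₀ → ∀ m : Fin Nf → ℝ, (∀ f, M₀ < m f) →
        SusceptibilityFloor Nf reg M₀ m → KurtosisCap Nf reg M₀ m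

/-! ## §2 The registered stubs (the ONLY `sorry`s of this file) -/

/-- (S1) deep extinction over the admissible capped class — open, size L (chessboard programme modulo
`ColumnPatternCost` ∧ `TransferStmt`). -/
theorem stub_deepExtinction : DeepExtinctionStmt := by
  sorry

/-- (S2) the edge witness: band extinction given deep extinction, and the susceptibility floor — open-problem. -/
theorem stub_edgeWitness : EdgeWitnessStmt := by
  sorry

/-- (S3) kurtosis cap of the index from its floor, over the admissible capped class — open, size M/L. -/
theorem stub_kurtosisCap : KurtosisStmt := by
  sorry

/-! ## §3 Composition (kernel-checked; no `sorry` below this line) -/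

/-- `√(χ₀ s⁴ / K₄) = √(χ₀/K₄) · s²`. [folklore] -/
theorem sqrt_floor_scale (χ₀ K₄ s : ℝ) :
    Real.sqrt (χ₀ * s ^ 4 / K₄) = Real.sqrt (χ₀ / K₄) * s ^ 2 := by
  have h4 : χ₀ * s ^ 4 / K₄ = χ₀ / K₄ * (s ^ 2) ^ 2 := by ring
  rw [h4, Real.sqrt_mul' _ (sq_nonneg _), Real.sqrt_sq (sq_nonneg s)]

/-- If `K₄/χ₀ ≤ s⁴` (`χ₀, K₄ > 0`) then `1 ≤ √(χ₀/K₄) · s²`. [folklore] -/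
theorem one_le_eta_mul_sq {χ₀ K₄ s : ℝ} (hχ₀ : 0 < χ₀) (hK₄ : 0 < K₄)
    (hV : K₄ / χ₀ ≤ s ^ 4) : 1 ≤ Real.sqrt (χ₀ / K₄) * s ^ 2 := by
  have hV' : K₄ ≤ s ^ 4 * χ₀ := (div_le_iff₀ hχ₀).1 hV
  have h1 : 1 ≤ χ₀ / K₄ * (s ^ 2) ^ 2 := by
    rw [div_mul_eq_mul_div, le_div_iff₀ hK₄, one_mul]
    nlinarith [hV']
  have h2 : Real.sqrt (χ₀ / K₄ * (s ^ 2) ^ 2) = Real.sqrt (χ₀ / K₄) * s ^ 2 := by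
    rw [Real.sqrt_mul' _ (sq_nonneg _), Real.sqrt_sq (sq_nonneg s)]
  calc (1 : ℝ) = Real.sqrt 1 := Real.sqrt_one.symm
    _ ≤ Real.sqrt (χ₀ / K₄ * (s ^ 2) ^ 2) := Real.sqrt_le_sqrt h1
    _ = Real.sqrt (χ₀ / K₄) * s ^ 2 := h2

/-- **TIGHT⁺ from FLOOR and CAP** (the argument of the landed `TightFromTwoMoments.tightPlus_of_indexMoments`, via the
landed intensive Hölder step `intensiveTight_of_indexMoments` at `V = (a_k(2L_k+1))⁴` and `physVolume_eventually_ge`):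
`η = √(χ₀/K₄)`. -/
theorem tightPlus_of_floor_of_cap {Nf : ℕ} (reg : QCDRegularisation Nf) (M₀ : ℝ) (m : Fin Nf → ℝ)
    (hF : SusceptibilityFloor Nf reg M₀ m) (hK : KurtosisCap Nf reg M₀ m) : TightPlus Nf reg M₀ m := by
  obtain ⟨χ₀, hχ₀, hF⟩ := hF
  obtain ⟨K₄, hK₄, hK⟩ := hK
  refine ⟨Real.sqrt (χ₀ / K₄), Real.sqrt_pos.2 (div_pos hχ₀ hK₄), fun M hM => ?_⟩
  filter_upwards [hF M hM, hK M hM, physVolume_eventually_ge reg (K₄ / χ₀)] with k hk hcap hvol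
  obtain ⟨hZ, hfloor⟩ := hk
  have hV : 0 < (reg.a k * (2 * reg.L k + 1 : ℝ)) ^ 4 :=
    pow_pos (mul_pos (reg.a_pos k) (by positivity)) 4
  have key := intensiveTight_of_indexMoments Nf (2 * reg.L k + 1) (reg.β k)
    (reg.mcrit k - reg.a k * M / reg.Zm k) (6 * (2 * reg.L k + 1 : ℝ) ^ 4) χ₀
    ((reg.a k * (2 * reg.L k + 1 : ℝ)) ^ 4) K₄ (fun f => reg.mcrit k + reg.a k * m f / reg.Zm k)
    hχ₀ hV hK₄ hZ hfloor hcap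
  rw [sqrt_floor_scale] at key
  exact max_le ((one_le_eta_mul_sq hχ₀ hK₄ hvol).trans key) key

/-- **The crux from the three stubs** (concludes `WindowExtinction` BY NAME).  The branch clause is derived from
`m_crit(k) → 0`; EXTINCT is the band implication of (S2) fed with the deep extinction of (S1) for the witness; TIGHT⁺ is
FLOOR (S2) + CAP (S3) through `tightPlus_of_floor_of_cap`. -/
theorem WindowExtinction_of : DeepExtinctionStmt → EdgeWitnessStmt → KurtosisStmt → WindowExtinction := by
  intro hD hE hK Nf hNf
  have h16 : Nf ≤ 16 := by rcases hNf with rfl | rfl <;> norm_num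
  obtain ⟨reg, hMS, hAS, hcap, hcrit, M₀, hM₀, c, hc, h⟩ := hE Nf hNf
  have hbr : ∀ᶠ k : ℕ in Filter.atTop, -1 < reg.mcrit k :=
    hcrit.eventually (eventually_gt_nhds (by norm_num : (-1 : ℝ) < 0))
  refine ⟨reg, hMS, hAS, hcap, hbr, M₀, hM₀, c, hc, fun m hm => ?_⟩
  have hpos : ∀ f, 0 < m f := fun f => hM₀.trans_lt (hm f)
  obtain ⟨hband, hfloor⟩ := h m hm
  have hdeep : DeepExtinctAt Nf reg deepConst m := hD Nf reg h16 hMS hAS hcap hcrit m hpos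
  exact ⟨hband hdeep,
    tightPlus_of_floor_of_cap reg M₀ m hfloor (hK Nf reg h16 hMS hAS hcap hcrit M₀ hM₀ m hm hfloor)⟩

/-- The crux along this skeleton, from the registered stubs (sorries only inside `stub_*`). -/
theorem windowExtinction_of_stubs : WindowExtinction :=
  WindowExtinction_of stub_deepExtinction stub_edgeWitness stub_kurtosisCap

end Summit.QuantumFields.QCD.Cruxes.WindowExtinction.Birth

end
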